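import Summits.AtomisticToContinuum.HydrodynamicLimit.Theorems.SuperextensiveClosureCostBlockEntropyBudgetTilt
import Mathlib.InformationTheory.KullbackLeibler.Basic
import Mathlib.MeasureTheory.Measure.LogLikelihoodRatio
import HarnessLib

/-!
# Crux `RestartPrinciple` (stmt-AtomisticToContinuum-12503), line `isentropic-regibbsification` — stub `stub_activityRelay`

ACTIVITY RELAY (symmetrised entropy bound). Two local Gibbs laws `P = LG(a, u₁, θ₁)`,
`Q = LG(a', u₁, θ₁)` of the same hard-sphere system (same velocity and temperature profiles,
activities `a, a' > 0` continuous, reduced density `σ ≤ 1/2`) are mutual exponential tilts by the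
one-body functional `W(z) = Σᵢ (log a'(xᵢ) − log a(xᵢ))`: `Q = P.tilted W`, i.e.
`dQ/dP = e^W / E_P[e^W]` (`localGibbsLaw_eq_tilted_activity`). Hence, by the two Gibbs
inequalities,
`KL(P ‖ Q) = log E_P e^W − E_P W` and `0 ≤ KL(Q ‖ P) = E_Q W − log E_P e^W`, so that
`KL(P ‖ Q) ≤ E_Q W − E_P W` (`klDiv_le_of_eq_tilted`, pure information theory over Mathlib's
`InformationTheory.klDiv`, `MeasureTheory.llr`, `Measure.tilted`).

References: C. Kipnis, C. Landim, *Scaling Limits of Interacting Particle Systems* (1999),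
App. 1 §8 (entropy and tilts); H. Spohn, *Large Scale Dynamics of Interacting Particles* (1991),
Part I §2.3 (local equilibrium states).
-/

noncomputable section

open Literature.MathematicalPhysics.KineticTheory Literature.Analysis.FluidPDE MeasureTheory Filter
  Set Topology InformationTheory
open scoped ENNReal

namespace Summit.AtomisticToContinuum.HydrodynamicLimit.Theorems.RestartPrinciple.IsentropicRegibbsification

/-! ### Pure measure theory: tilts and the symmetrised Gibbs inequality -/

/-- A probability measure of the form `μ.withDensity (c · e^f)` (with `e^f` `μ`-integrable) is the
exponential tilt `μ.tilted f`: the normalisation forces `c = (∫ e^f dμ)⁻¹`. [folklore] -/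
theorem withDensity_const_mul_exp_eq_tilted {α : Type*} [MeasurableSpace α] {μ : Measure α}
    {f : α → ℝ} {c : ℝ} (hf : Integrable (fun x => Real.exp (f x)) μ)
    (hprob : IsProbabilityMeasure (μ.withDensity fun x => ENNReal.ofReal (c * Real.exp (f x)))) :
    (μ.withDensity fun x => ENNReal.ofReal (c * Real.exp (f x))) = μ.tilted f := by
  have h1 : (μ.withDensity fun x => ENNReal.ofReal (c * Real.exp (f x))) univ = 1 := measure_univ
  rw [withDensity_apply _ MeasurableSet.univ, Measure.restrict_univ] at h1
  have hc : 0 < c := by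
    by_contra hc
    push Not at hc
    have h0 : (fun x => ENNReal.ofReal (c * Real.exp (f x))) = fun _ => 0 := by
      funext x
      exact ENNReal.ofReal_of_nonpos (mul_nonpos_of_nonpos_of_nonneg hc (Real.exp_pos _).le)
    rw [h0, lintegral_zero] at h1
    exact zero_ne_one h1
  have h2 : ∫⁻ x, ENNReal.ofReal (c * Real.exp (f x)) ∂μ =
      ENNReal.ofReal c * ENNReal.ofReal (∫ x, Real.exp (f x) ∂μ) := by
    simp_rw [ENNReal.ofReal_mul hc.le]
    rw [lintegral_const_mul' _ _ ENNReal.ofReal_ne_top,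
      ofReal_integral_eq_lintegral_ofReal hf (ae_of_all _ fun _ => (Real.exp_pos _).le)]
  rw [h2, ← ENNReal.ofReal_mul hc.le, ENNReal.ofReal_eq_one] at h1
  have hc' : c = (∫ x, Real.exp (f x) ∂μ)⁻¹ := eq_inv_of_mul_eq_one_left h1
  unfold Measure.tilted
  congr 1
  funext x
  rw [hc', div_eq_inv_mul]

/-- **Symmetrised Gibbs inequality for a tilt.** If `Q = P.tilted W` for probability measures
`P, Q` and a `P`- and `Q`-integrable exponent `W` with `e^W` `P`-integrable, then
`KL(P ‖ Q) = log E_P e^W − E_P W ≤ E_Q W − E_P W`, the inequality being `0 ≤ KL(Q ‖ P) =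
E_Q W − log E_P e^W`. [cite: KipnisLandim1999, App. 1 §8] -/
theorem klDiv_le_of_eq_tilted {α : Type*} [MeasurableSpace α] {P Q : Measure α}
    [IsProbabilityMeasure P] [IsProbabilityMeasure Q] (W : α → ℝ) (hQ : Q = P.tilted W)
    (hWP : Integrable W P) (hWQ : Integrable W Q)
    (hexp : Integrable (fun x => Real.exp (W x)) P) :
    klDiv P Q ≤ ENNReal.ofReal ((∫ x, W x ∂Q) - ∫ x, W x ∂P) := by
  -- `KL(P ‖ Q) = log E_P e^W − E_P W`
  have hPQ : P ≪ Q := by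
    rw [hQ]
    exact absolutelyContinuous_tilted hexp
  have hllrPP : Integrable (llr P P) P := (integrable_congr (llr_self P)).2 (integrable_zero _ _ _)
  have hint : Integrable (llr P Q) P := by
    rw [hQ]
    exact integrable_llr_tilted_right Measure.AbsolutelyContinuous.rfl hWP hllrPP hexp
  have hKL : ∫ x, llr P Q x ∂P = Real.log (∫ x, Real.exp (W x) ∂P) - ∫ x, W x ∂P := by
    rw [hQ, integral_llr_tilted_right Measure.AbsolutelyContinuous.rfl hWP hexp hllrPP,
      integral_congr_ae (llr_self P)]
    simp only [Pi.zero_apply, integral_zero]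
    ring
  -- `0 ≤ KL(Q ‖ P) = E_Q W − log E_P e^W`
  have hQP : Q ≪ P := by
    rw [hQ]
    exact tilted_absolutelyContinuous P W
  have hllrQP : llr Q P =ᵐ[Q] fun x => W x - Real.log (∫ x, Real.exp (W x) ∂P) := by
    have h := log_rnDeriv_tilted_left_self hexp
    rw [← hQ] at h
    exact hQP.ae_le h
  have hintQ : Integrable (llr Q P) Q :=
    (integrable_congr hllrQP).2 (hWQ.sub (integrable_const _))
  have hGibbs := integral_llr_add_sub_measure_univ_nonneg hQP hintQ
  rw [integral_congr_ae hllrQP, integral_sub hWQ (integrable_const _), integral_const,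
    probReal_univ, probReal_univ, one_smul] at hGibbs
  -- conclusion
  rw [klDiv_of_ac_of_integrable hPQ hint, probReal_univ, probReal_univ, hKL]
  exact ENNReal.ofReal_le_ofReal (by linarith)

/-! ### The tilt structure of local Gibbs laws in the activity -/

variable {a a' θ₁ : T3 → ℝ} {u₁ : T3 → V3} {σ : ℝ}

/-- Changing the activity multiplies the one-particle profile by `a'/a`:
`localGibbsProfile a' u θ (x, v) = (a' x / a x) · localGibbsProfile a u θ (x, v)` (`a x ≠ 0`).
[folklore] -/
theorem localGibbsProfile_eq_div_mul (ha0 : ∀ x, 0 < a x) (y : T3 × V3) :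
    localGibbsProfile a' u₁ θ₁ y = a' y.1 / a y.1 * localGibbsProfile a u₁ θ₁ y := by
  simp only [localGibbsProfile]
  rw [← mul_assoc, div_mul_cancel₀ _ (ha0 y.1).ne']

/-- The activity log-ratio statistic `W(z) = Σᵢ (log a'(xᵢ) − log a(xᵢ))` is measurable
(continuous activities). [folklore] -/
theorem measurable_sum_log_activity_sub (ha : Continuous a) (ha' : Continuous a') (n : ℕ) :
    Measurable fun z : Config n (Fin 3) T3 => ∑ i, (Real.log (a' (z i).1) - Real.log (a (z i).1)) := by
  refine Finset.measurable_sum _ fun i _ => ?_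
  exact (Real.measurable_log.comp (ha'.measurable.comp (measurable_pi_apply i).fst)).sub
    (Real.measurable_log.comp (ha.measurable.comp (measurable_pi_apply i).fst))

/-- The activity log-ratio statistic is bounded: `|W(z)| ≤ n · sup |log a' − log a|`
(continuous positive activities on the compact torus). [folklore] -/
theorem exists_abs_sum_log_activity_sub_le (ha : Continuous a) (ha' : Continuous a')
    (ha0 : ∀ x, 0 < a x) (ha0' : ∀ x, 0 < a' x) (n : ℕ) :
    ∃ C : ℝ, ∀ z : Config n (Fin 3) T3,
      |∑ i, (Real.log (a' (z i).1) - Real.log (a (z i).1))| ≤ C := by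
  obtain ⟨B, -, hB⟩ := exists_forall_abs_le_of_continuous
    (χ := fun x => Real.log (a' x) - Real.log (a x))
    ((ha'.log fun x => (ha0' x).ne').sub (ha.log fun x => (ha0 x).ne'))
  refine ⟨n * B, fun z => ?_⟩
  calc |∑ i, (Real.log (a' (z i).1) - Real.log (a (z i).1))|
      ≤ ∑ i, |Real.log (a' (z i).1) - Real.log (a (z i).1)| := Finset.abs_sum_le_sum_abs _ _
    _ ≤ ∑ _i : Fin n, B := Finset.sum_le_sum fun i _ => hB (z i).1
    _ = n * B := by simp

/-- The activity log-ratio statistic `W` and its exponential are integrable under every finite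
measure on phase space (they are bounded and measurable). [folklore] -/
theorem integrable_sum_log_activity_sub (ha : Continuous a) (ha' : Continuous a')
    (ha0 : ∀ x, 0 < a x) (ha0' : ∀ x, 0 < a' x) (n : ℕ) (μ : Measure (Config n (Fin 3) T3))
    [IsFiniteMeasure μ] :
    Integrable (fun z : Config n (Fin 3) T3 =>
        ∑ i, (Real.log (a' (z i).1) - Real.log (a (z i).1))) μ ∧
      Integrable (fun z : Config n (Fin 3) T3 =>
        Real.exp (∑ i, (Real.log (a' (z i).1) - Real.log (a (z i).1)))) μ := by
  obtain ⟨C, hC⟩ := exists_abs_sum_log_activity_sub_le ha ha' ha0 ha0' n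
  have hm := measurable_sum_log_activity_sub ha ha' n
  refine ⟨Integrable.of_bound hm.aestronglyMeasurable C (ae_of_all _ fun z => ?_),
    Integrable.of_bound hm.exp.aestronglyMeasurable (Real.exp C) (ae_of_all _ fun z => ?_)⟩
  · rw [Real.norm_eq_abs]
    exact hC z
  · rw [Real.norm_eq_abs, abs_of_pos (Real.exp_pos _)]
    exact Real.exp_le_exp.2 ((le_abs_self _).trans (hC z))

/-- **Tilt identity in the activity, density form.** For continuous profiles `a, a', θ₁ > 0`,
`u₁` and `σ ≤ 1/2` (both partition functions positive),
`LG(a', u₁, θ₁) = LG(a, u₁, θ₁).withDensity ((Z_a/Z_{a'}) · exp (Σᵢ (log a'(xᵢ) − log a(xᵢ))))`: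
the Maxwellian velocity factors coincide and cancel. [cite: KipnisLandim1999, Ch. 6 §1] -/
theorem localGibbsLaw_eq_withDensity_activity (ha : Continuous a) (ha' : Continuous a')
    (hθ : Continuous θ₁) (hu : Continuous u₁) (ha0 : ∀ x, 0 < a x) (ha0' : ∀ x, 0 < a' x)
    (hθ0 : ∀ x, 0 < θ₁ x) (hσ2 : σ ≤ 1 / 2) (N : ℕ)
    (Φ : HardSphereFlow (Torus.geometry (Fin 3)) (hsDiameter σ N) (N + 1)) :
    localGibbsLaw σ a' u₁ θ₁ N Φ =
      (localGibbsLaw σ a u₁ θ₁ N Φ).withDensity fun z =>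
        ENNReal.ofReal
          (canonicalPartition (Torus.geometry (Fin 3)) (hsDiameter σ N) (N + 1)
              (localGibbsProfile a u₁ θ₁) /
            canonicalPartition (Torus.geometry (Fin 3)) (hsDiameter σ N) (N + 1)
              (localGibbsProfile a' u₁ θ₁) *
          Real.exp (∑ i, (Real.log (a' (z i).1) - Real.log (a (z i).1)))) := by
  -- notation
  set G3 := Torus.geometry (Fin 3) with hG3
  set ε := hsDiameter σ N with hε
  set f := localGibbsProfile a u₁ θ₁ with hf
  set f' := localGibbsProfile a' u₁ θ₁ with hf'
  set Z := canonicalPartition G3 ε (N + 1) f with hZ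
  set Z' := canonicalPartition G3 ε (N + 1) f' with hZ'
  -- positivity of the partition functions (σ ≤ 1/2) and of the reference profile
  have hZpos : 0 < Z := by
    rw [hZ, hf, hG3, canonicalPartition_eq_posPartition ha hθ hu (fun x => (ha0 x).le) hθ0]
    exact posPartition_pos ha ha0 hσ2 N
  have hZ'pos : 0 < Z' := by
    rw [hZ', hf', hG3, canonicalPartition_eq_posPartition ha' hθ hu (fun x => (ha0' x).le) hθ0]
    exact posPartition_pos ha' ha0' hσ2 N
  have hf_nn : ∀ y, 0 ≤ f y := fun y =>
    localGibbsProfile_nonneg (fun x => (ha0 x).le) (fun x => (hθ0 x).le) y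
  -- measurability
  have hfm : Measurable f := measurable_localGibbsProfile ha hθ hu
  have hcd : Measurable fun z : Config (N + 1) (Fin 3) T3 =>
      ENNReal.ofReal (canonicalDensity G3 ε (N + 1) f z) :=
    (measurable_canonicalDensity ε (N + 1) hfm).ennreal_ofReal
  have hratio : Measurable fun z : Config (N + 1) (Fin 3) T3 =>
      ENNReal.ofReal (Z / Z' * Real.exp (∑ i, (Real.log (a' (z i).1) - Real.log (a (z i).1)))) :=
    (measurable_const.mul (measurable_sum_log_activity_sub ha ha' (N + 1)).exp).ennreal_ofReal
  -- both sides as `volume.withDensity`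
  rw [localGibbsLaw_eq, localGibbsLaw_eq]
  simp only [localGibbsMeasure]
  rw [← withDensity_mul _ hcd hratio]
  refine withDensity_congr_ae (Filter.Eventually.of_forall fun z => ?_)
  simp only [Pi.mul_apply]
  by_cases hzD : z ∈ hardSphereDomain G3 (N + 1) ε
  · -- on the hard-sphere domain: algebra
    have hcdf : canonicalDensity G3 ε (N + 1) f z = Z⁻¹ * ∏ i, f (z i) := by
      simp [canonicalDensity, Set.indicator_of_mem hzD, tensorPow, hZ]
    have hcdf' : canonicalDensity G3 ε (N + 1) f' z = Z'⁻¹ * ∏ i, f' (z i) := by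
      simp [canonicalDensity, Set.indicator_of_mem hzD, tensorPow, hZ']
    have hexp : Real.exp (∑ i, (Real.log (a' (z i).1) - Real.log (a (z i).1))) =
        ∏ i, a' (z i).1 / a (z i).1 := by
      rw [Real.exp_sum]
      exact Finset.prod_congr rfl fun i _ => by
        rw [Real.exp_sub, Real.exp_log (ha0' _), Real.exp_log (ha0 _)]
    have hprod : ∏ i, f' (z i) = (∏ i, a' (z i).1 / a (z i).1) * ∏ i, f (z i) := by
      rw [← Finset.prod_mul_distrib]
      exact Finset.prod_congr rfl fun i _ => localGibbsProfile_eq_div_mul ha0 (z i)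
    have hPf_nn : 0 ≤ ∏ i, f (z i) := Finset.prod_nonneg fun i _ => hf_nn (z i)
    have hcdf_nn : 0 ≤ Z⁻¹ * ∏ i, f (z i) := mul_nonneg (inv_nonneg.2 hZpos.le) hPf_nn
    rw [hcdf, hcdf', ← ENNReal.ofReal_mul hcdf_nn, hexp, hprod]
    congr 1
    field_simp
  · -- off the domain both canonical densities vanish
    rw [canonicalDensity_eq_zero_of_notMem G3 ε (N + 1) f hzD,
      canonicalDensity_eq_zero_of_notMem G3 ε (N + 1) f' hzD]
    simp

/-- **Tilt identity in the activity.** For continuous profiles `a, a', θ₁ > 0`, `u₁` and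
`σ ≤ 1/2`, the local Gibbs law with activity `a'` is the exponential tilt of the one with
activity `a` by `W(z) = Σᵢ (log a'(xᵢ) − log a(xᵢ))`: `LG(a') = LG(a).tilted W`, i.e.
`dLG(a')/dLG(a) = e^W / E_{LG(a)} e^W`. [cite: KipnisLandim1999, Ch. 6 §1] -/
theorem localGibbsLaw_eq_tilted_activity (ha : Continuous a) (ha' : Continuous a')
    (hθ : Continuous θ₁) (hu : Continuous u₁) (ha0 : ∀ x, 0 < a x) (ha0' : ∀ x, 0 < a' x)
    (hθ0 : ∀ x, 0 < θ₁ x) (hσ2 : σ ≤ 1 / 2) (N : ℕ)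
    (Φ : HardSphereFlow (Torus.geometry (Fin 3)) (hsDiameter σ N) (N + 1)) :
    localGibbsLaw σ a' u₁ θ₁ N Φ =
      (localGibbsLaw σ a u₁ θ₁ N Φ).tilted fun z =>
        ∑ i, (Real.log (a' (z i).1) - Real.log (a (z i).1)) := by
  have hW := localGibbsLaw_eq_withDensity_activity ha ha' hθ hu ha0 ha0' hθ0 hσ2 N Φ
  haveI : IsProbabilityMeasure (localGibbsLaw σ a u₁ θ₁ N Φ) :=
    isProbabilityMeasure_localGibbsLaw ha hθ hu ha0 hθ0 hσ2 N Φ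
  have hprob : IsProbabilityMeasure (localGibbsLaw σ a' u₁ θ₁ N Φ) :=
    isProbabilityMeasure_localGibbsLaw ha' hθ hu ha0' hθ0 hσ2 N Φ
  rw [hW] at hprob ⊢
  exact withDensity_const_mul_exp_eq_tilted
    (integrable_sum_log_activity_sub ha ha' ha0 ha0' (N + 1) _).2 hprob

/-! ### The registered stub -/

/-- **Activity relay (symmetrised entropy bound)** — registered stub `stub_activityRelay` of line
`isentropic-regibbsification`, crux stmt-AtomisticToContinuum-12503. Two local Gibbs laws of the
same hard-sphere system with the same velocity and temperature profiles and activities `a, a'`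
are mutual exponential tilts by `W(z) = Σᵢ (log a'(xᵢ) − log a(xᵢ))` (`dQ/dP = e^W / E_P[e^W]`,
`localGibbsLaw_eq_tilted_activity`), hence
`KL(P ‖ Q) = log E_P e^W − E_P W ≤ E_Q W − E_P W` (`0 ≤ KL(Q ‖ P) = E_Q W − log E_P e^W`).
[cite: KipnisLandim1999, App. 1 §8] -/
theorem stub_activityRelay :
    ∀ σ : ℝ, 0 < σ → σ ≤ 1 / 2 →
      ∀ (a a' θ₁ : T3 → ℝ) (u₁ : T3 → V3), Continuous a → Continuous a' → Continuous θ₁ →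
      Continuous u₁ → (∀ x, 0 < a x) → (∀ x, 0 < a' x) → (∀ x, 0 < θ₁ x) →
      ∀ (N : ℕ) (Φ : HardSphereFlow (Torus.geometry (Fin 3)) (hsDiameter σ N) (N + 1)),
      klDiv (localGibbsLaw σ a u₁ θ₁ N Φ) (localGibbsLaw σ a' u₁ θ₁ N Φ) ≤
        ENNReal.ofReal
          ((∫ z, ∑ i, (Real.log (a' (z i).1) - Real.log (a (z i).1)) ∂(localGibbsLaw σ a' u₁ θ₁ N Φ)) -
            ∫ z, ∑ i, (Real.log (a' (z i).1) - Real.log (a (z i).1)) ∂(localGibbsLaw σ a u₁ θ₁ N Φ)) := by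
  intro σ _hσ hσ2 a a' θ₁ u₁ ha ha' hθ hu ha0 ha0' hθ0 N Φ
  haveI : IsProbabilityMeasure (localGibbsLaw σ a u₁ θ₁ N Φ) :=
    isProbabilityMeasure_localGibbsLaw ha hθ hu ha0 hθ0 hσ2 N Φ
  haveI : IsProbabilityMeasure (localGibbsLaw σ a' u₁ θ₁ N Φ) :=
    isProbabilityMeasure_localGibbsLaw ha' hθ hu ha0' hθ0 hσ2 N Φ
  have hP := integrable_sum_log_activity_sub ha ha' ha0 ha0' (N + 1) (localGibbsLaw σ a u₁ θ₁ N Φ)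
  have hQ := integrable_sum_log_activity_sub ha ha' ha0 ha0' (N + 1) (localGibbsLaw σ a' u₁ θ₁ N Φ)
  have hQt := localGibbsLaw_eq_tilted_activity ha ha' hθ hu ha0 ha0' hθ0 hσ2 N Φ
  have key := klDiv_le_of_eq_tilted (P := localGibbsLaw σ a u₁ θ₁ N Φ)
    (Q := localGibbsLaw σ a' u₁ θ₁ N Φ)
    (fun z : Config (N + 1) (Fin 3) T3 => ∑ i, (Real.log (a' (z i).1) - Real.log (a (z i).1)))
    hQt hP.1 hQ.1 hP.2
  exact key

end Summit.AtomisticToContinuum.HydrodynamicLimit.Theorems.RestartPrinciple.IsentropicRegibbsification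

end
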